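import Summits.SmoothPoincare4.SmoothPoincare4.Theorems.SblfDescentRungOneHelperDegreeLift
import Summits.SmoothPoincare4.SmoothPoincare4.Theorems.SblfDescentRungOneDefs
import Mathlib.Analysis.SpecialFunctions.Trigonometric.Arctan
import HarnessLib

/-!
# Fibre structure of a rigid collar: off the tube the angular coordinate avoids the rigid arc

Helper layer `helper_degree_collar` of the brick `helper_sliceGluing_vanishingDegree` (apex leaf
F0, the degree lemma) of line `Sketch`, crux `SblfDescent.RungOne`
(crux item stmt-SmoothPoincare4-18531).

Let `(ιC, aC, bC)` be rigid torus coordinates on the band `{s₁ < ⟪f, v⟫ < s₂}` matched to the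
fold tube `ν` (`IsRigidCollar f v ν σ arctan s₁ s₂ ε₂ ιC aC bC`, `σ = ±1`): in the tube,
`aC (ν (u, x)) = R(-arctan x₂) (u₀, σ u₁)`, i.e. with `u = circlePt φ`,
`aC = circlePt (σ φ - arctan x₂ / 2π)` (`helper_degree_rigidDir_circlePt`).  On the torus fibre
`F` over the base point of longitude `u` and height `s` the tube part is the vanishing annulus
`A = {Q = s, ‖x‖ < ε♭}`, on which `x₂` ranges over `(-m, m)`, `m = √((ε♭² - s)/2)`.

**`helper_degree_collar` (registered).**  A point `x` of the band at height `s < ε♭²` which is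
NOT in the `ε♭`-tube has angular coordinate `aC x = circlePt ℓ` with `σ φ - ℓ` at distance
`≥ arctan m / 2π` from `ℤ`.  Indeed, otherwise `σ φ - ℓ ≡ θ / 2π` with `|θ| < arctan m`, and the
circle `{x₂ = tan θ} ⊆ A` lies in the level set `F ∩ aC⁻¹ (aC x)`, which is the embedded circle
`b ↦ ιC ((aC x, b), (u, s))` (`section_eq` + `formula`); a continuous injection of a circle into
a circle is onto (`helper_degree_surjective_of_injective`), so `x` itself lies on the tube circle
— a contradiction.  This is the only place where the product structure of the collar enters the
degree lemma.

## References

* R. İ. Baykur, S. Kamada, *Classification of broken Lefschetz fibrations with small fiber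
  genera*, J. Math. Soc. Japan 67 (2015), §2. [BaykurKamada2015]
-/

set_option linter.dupNamespace false

noncomputable section

open scoped Manifold ContDiff Topology RealInnerProductSpace
open Set Function Literature.Topology.FourManifolds

namespace Summit.SmoothPoincare4.SmoothPoincare4.Cruxes.RungOne.Sketch

/-- **The rigid direction in angles**: for `σ = ±1`,
`rigidDir σ θ (circlePt φ) = circlePt (σ φ - θ / 2π)`. [cite: BaykurKamada2015, §2] -/
theorem helper_degree_rigidDir_circlePt {σ : ℝ} (hσ : σ = 1 ∨ σ = -1) (θ φ : ℝ) :
    rigidDir σ θ (circlePt φ) =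
      ((circlePt (σ * φ - θ / (2 * Real.pi)) : Metric.sphere (0 : EuclideanSpace ℝ (Fin 2)) 1) :
        EuclideanSpace ℝ (Fin 2)) := by
  have h2π : 2 * Real.pi * (σ * φ - θ / (2 * Real.pi)) = σ * (2 * Real.pi * φ) - θ := by
    field_simp
  have e0 : rigidDir σ θ (circlePt φ) 0 =
      ((circlePt (σ * φ - θ / (2 * Real.pi)) : Metric.sphere (0 : EuclideanSpace ℝ (Fin 2)) 1) :
        EuclideanSpace ℝ (Fin 2)) 0 := by
    rw [rigidDir_apply_zero, circlePt_apply_zero, circlePt_apply_zero, circlePt_apply_one, h2π]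
    rcases hσ with rfl | rfl
    · rw [one_mul, one_mul, Real.cos_sub]; ring
    · rw [neg_one_mul, neg_one_mul, show -(2 * Real.pi * φ) - θ = -(2 * Real.pi * φ + θ) by ring,
        Real.cos_neg, Real.cos_add]; ring
  have e1 : rigidDir σ θ (circlePt φ) 1 =
      ((circlePt (σ * φ - θ / (2 * Real.pi)) : Metric.sphere (0 : EuclideanSpace ℝ (Fin 2)) 1) :
        EuclideanSpace ℝ (Fin 2)) 1 := by
    rw [rigidDir_apply_one, circlePt_apply_one, circlePt_apply_zero, circlePt_apply_one, h2π]
    rcases hσ with rfl | rfl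
    · rw [one_mul, one_mul, Real.sin_sub]; ring
    · rw [neg_one_mul, neg_one_mul, show -(2 * Real.pi * φ) - θ = -(2 * Real.pi * φ + θ) by ring,
        Real.sin_neg, Real.sin_add]; ring
  exact PiLp.ext (Fin.forall_fin_two.2 ⟨e0, e1⟩)

/-- Two points of `𝕊²` with the same three coordinates are equal. [folklore] -/
theorem helper_degree_sphere_ext {p q : Metric.sphere (0 : EuclideanSpace ℝ (Fin 3)) 1}
    (h0 : (p : EuclideanSpace ℝ (Fin 3)) 0 = (q : EuclideanSpace ℝ (Fin 3)) 0)
    (h1 : (p : EuclideanSpace ℝ (Fin 3)) 1 = (q : EuclideanSpace ℝ (Fin 3)) 1)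
    (h2 : (p : EuclideanSpace ℝ (Fin 3)) 2 = (q : EuclideanSpace ℝ (Fin 3)) 2) : p = q := by
  apply Subtype.ext
  refine PiLp.ext fun i => ?_
  fin_cases i
  · exact h0
  · exact h1
  · exact h2

/-- A positive multiple of a unit vector of `ℝ²` determines the vector: if `c • u = c' • u'` with
`c, c' > 0` and `‖u‖ = ‖u'‖ = 1` then `u = u'`. [folklore] -/
theorem helper_degree_unit_eq_of_smul_eq {c c' : ℝ} (hc : 0 < c) (hc' : 0 < c')
    {u u' : Metric.sphere (0 : EuclideanSpace ℝ (Fin 2)) 1}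
    (h0 : c * (u : EuclideanSpace ℝ (Fin 2)) 0 = c' * (u' : EuclideanSpace ℝ (Fin 2)) 0)
    (h1 : c * (u : EuclideanSpace ℝ (Fin 2)) 1 = c' * (u' : EuclideanSpace ℝ (Fin 2)) 1) :
    c = c' ∧ u = u' := by
  have hv : c • (u : EuclideanSpace ℝ (Fin 2)) = c' • (u' : EuclideanSpace ℝ (Fin 2)) :=
    PiLp.ext (Fin.forall_fin_two.2 ⟨by simpa using h0, by simpa using h1⟩)
  have hn := congrArg (fun z : EuclideanSpace ℝ (Fin 2) => ‖z‖) hv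
  simp only [norm_smul, Real.norm_eq_abs, norm_eq_of_mem_sphere, mul_one, abs_of_pos hc,
    abs_of_pos hc'] at hn
  subst hn
  exact ⟨rfl, Subtype.ext (smul_right_injective _ hc.ne' hv)⟩

/-- `v₂² = 1` for the pole `v = (0, 0, v₂)`. [folklore] -/
theorem helper_degree_pole_sq (v : Metric.sphere (0 : EuclideanSpace ℝ (Fin 3)) 1)
    (hv0 : (v : EuclideanSpace ℝ (Fin 3)) 0 = 0) (hv1 : (v : EuclideanSpace ℝ (Fin 3)) 1 = 0) :
    (v : EuclideanSpace ℝ (Fin 3)) 2 ^ 2 = 1 := by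
  have hn := norm_eq_of_mem_sphere v
  have : ‖(v : EuclideanSpace ℝ (Fin 3))‖ ^ 2 = 1 := by rw [hn]; norm_num
  rw [EuclideanSpace.norm_eq, Real.sq_sqrt (Finset.sum_nonneg fun i _ => by positivity),
    Fin.sum_univ_three] at this
  simpa [hv0, hv1] using this

/-- **Off the tube, the angular coordinate of a rigid collar avoids the rigid arc** (registered
layer C of the degree lemma `helper_sliceGluing_vanishingDegree`; see the module docstring).
[cite: BaykurKamada2015, §2] -/
theorem helper_degree_collar : ∀ (X : Type) [TopologicalSpace X] [ChartedSpace (EuclideanSpace ℝ (Fin 4)) X] (f : X → Metric.sphere (0 : EuclideanSpace ℝ (Fin 3)) 1) (v : Metric.sphere (0 : EuclideanSpace ℝ (Fin 3)) 1), (v : EuclideanSpace ℝ (Fin 3)) 0 = 0 → (v : EuclideanSpace ℝ (Fin 3)) 1 = 0 → ∀ (ε : ℝ) (ν : (Metric.sphere (0 : EuclideanSpace ℝ (Fin 2)) 1) × EuclideanSpace ℝ (Fin 3) → X), IsFoldTube f v ε ν → ∀ (σ s₁ s₂ ε₂ : ℝ) (ιC : ((Metric.sphere (0 : EuclideanSpace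 ℝ (Fin 2)) 1) × (Metric.sphere (0 : EuclideanSpace ℝ (Fin 2)) 1)) × ((Metric.sphere (0 : EuclideanSpace ℝ (Fin 2)) 1) × ℝ) → X) (aC bC : X → Metric.sphere (0 : EuclideanSpace ℝ (Fin 2)) 1), IsRigidCollar f v ν σ Real.arctan s₁ s₂ ε₂ ιC aC bC → (σ = 1 ∨ σ = -1) → ∀ (δ : ℝ), 0 < δ → δ ≤ ε₂ → δ ≤ ε → ∀ (x : X) (s c φ ℓ : ℝ), (v : EuclideanSpace ℝ (Fin 3)) 2 * ((f x : Metric.sphere (0 : EuclideanSpace ℝ (Fin 3)) 1) : EuclideanSpace ℝ (Fin 3)) 2 = s → s₁ < s → s < s₂ → s < δ ^ 2 → 0 < c → ((f x : Metric.sphere (0 : EuclideanSpace ℝ (Fin 3)) 1) : EuclideanSpace ℝ (Fin 3)) 0 = c * ((circlePt φ : Metric.sphere (0 : EuclideanSpace ℝ (Fin 2)) 1) : EuclideanSpace ℝ (Fin 2)) 0 → ((f x : Metric.sphere (0 : EuclideanSpace ℝ (Fin 3)) 1) : EuclideanSpace ℝ (Fin 3)) 1 = c * ((circlePt φ : Metric.sphere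 (0 : EuclideanSpace ℝ (Fin 2)) 1) : EuclideanSpace ℝ (Fin 2)) 1 → aC x = circlePt ℓ → x ∉ ν '' (Set.univ ×ˢ Metric.ball (0 : EuclideanSpace ℝ (Fin 3)) δ) → ∀ k : ℤ, Real.arctan (√((δ ^ 2 - s) / 2)) / (2 * Real.pi) ≤ |σ * φ - ℓ - k| := by
  intro X _ _ f v hv0 hv1 ε ν hT σ s₁ s₂ ε₂ ιC aC bC hC hσ δ hδ hδε₂ hδε x s c φ ℓ hxs hs1 hs2 hsδ hc
    hf0 hf1 haC hx k
  by_contra hlt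
  rw [not_le] at hlt
  have hv2 := helper_degree_pole_sq v hv0 hv1
  have hπ := Real.pi_pos
  -- numerical facts about the level `s`
  have hs0 : 0 < s := hC.pos.trans hs1
  have hδ1 : δ < 1 := lt_of_le_of_lt hδε hT.lt_one
  have hs_lt_one : s < 1 := by nlinarith
  have h1s : 0 < 1 - s ^ 2 := by nlinarith
  have hsq : 0 < √(1 - s ^ 2) := Real.sqrt_pos.2 h1s
  -- the transverse parameter `y₂ = tan θ`, `θ = 2π (σ φ - ℓ - k)`
  set m : ℝ := √((δ ^ 2 - s) / 2) with hm
  have hm0 : 0 < m := Real.sqrt_pos.2 (by linarith)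
  have hmsq : m ^ 2 = (δ ^ 2 - s) / 2 := Real.sq_sqrt (by linarith)
  set θ : ℝ := 2 * Real.pi * (σ * φ - ℓ - k) with hθ
  have hθabs : |θ| < Real.arctan m := by
    rw [hθ, abs_mul, abs_of_pos (by positivity : (0 : ℝ) < 2 * Real.pi)]
    rwa [lt_div_iff₀ (by positivity), mul_comm] at hlt
  have hat2 : Real.arctan m < Real.pi / 2 := Real.arctan_lt_pi_div_two m
  have hθlt : θ < Real.pi / 2 := lt_trans (abs_lt.1 hθabs).2 hat2
  have hθgt : -(Real.pi / 2) < θ := by have := (abs_lt.1 hθabs).1; linarith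
  set y₂ : ℝ := Real.tan θ with hy₂
  have hy₂abs : |y₂| < m := by
    rw [abs_lt]
    constructor
    · have h := Real.tan_lt_tan_of_lt_of_lt_pi_div_two (by linarith [Real.neg_pi_div_two_lt_arctan m])
        hθlt (abs_lt.1 hθabs).1
      rwa [Real.tan_neg, Real.tan_arctan] at h
    · have h := Real.tan_lt_tan_of_lt_of_lt_pi_div_two hθgt hat2 (abs_lt.1 hθabs).2
      rwa [Real.tan_arctan] at h
  have hy₂sq : y₂ ^ 2 < m ^ 2 := by
    rw [← sq_abs]; exact pow_lt_pow_left₀ hy₂abs (abs_nonneg _) two_ne_zero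
  have harctan : Real.arctan y₂ = θ := Real.arctan_tan hθgt hθlt
  set ρ : ℝ := √(s + y₂ ^ 2) with hρ
  have hρ0 : 0 < ρ := Real.sqrt_pos.2 (by positivity)
  have hρsq : ρ ^ 2 = s + y₂ ^ 2 := Real.sq_sqrt (by positivity)
  -- the base point of `x`: longitude `circlePt φ`, height `s`, `f x` in coordinates
  obtain ⟨u', hu'⟩ := hC.section_eq x (by rw [hxs]; exact hs1) (by rw [hxs]; exact hs2)
  rw [hxs] at hu'
  obtain ⟨hfx0, hfx1, hfx2, -, -⟩ := hC.formula (aC x) (bC x) u' s hs1 hs2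
  rw [hu'] at hfx0 hfx1 hfx2
  obtain ⟨hcs, hu'φ⟩ := helper_degree_unit_eq_of_smul_eq hc hsq (hf0.symm.trans hfx0)
    (hf1.symm.trans hfx1)
  -- `u' = circlePt φ` and `c = √(1 - s²)`; hence `x = ιC ((aC x, bC x), (circlePt φ, s))`
  rw [← hu'φ] at hu'
  -- the tube circle `b ↦ ν (circlePt φ, (ρ b, y₂))`
  have hb0c : Continuous fun b : Metric.sphere (0 : EuclideanSpace ℝ (Fin 2)) 1 =>
      (b : EuclideanSpace ℝ (Fin 2)) 0 := (EuclideanSpace.proj (0 : Fin 2)).continuous.comp continuous_subtype_val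
  have hb1c : Continuous fun b : Metric.sphere (0 : EuclideanSpace ℝ (Fin 2)) 1 =>
      (b : EuclideanSpace ℝ (Fin 2)) 1 := (EuclideanSpace.proj (1 : Fin 2)).continuous.comp continuous_subtype_val
  set yv : Metric.sphere (0 : EuclideanSpace ℝ (Fin 2)) 1 → EuclideanSpace ℝ (Fin 3) := fun b =>
    WithLp.toLp 2 ![ρ * (b : EuclideanSpace ℝ (Fin 2)) 0, ρ * (b : EuclideanSpace ℝ (Fin 2)) 1, y₂] with hyv
  have hyv0 : ∀ b, yv b 0 = ρ * (b : EuclideanSpace ℝ (Fin 2)) 0 := fun b => rfl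
  have hyv1 : ∀ b, yv b 1 = ρ * (b : EuclideanSpace ℝ (Fin 2)) 1 := fun b => rfl
  have hyv2 : ∀ b, yv b 2 = y₂ := fun b => rfl
  have hyvc : Continuous yv := by
    refine (PiLp.continuous_toLp 2 _).comp (continuous_pi fun i => ?_)
    fin_cases i
    · simp only [Fin.zero_eta, Fin.isValue, Matrix.cons_val_zero]
      exact continuous_const.mul hb0c
    · simp only [Fin.mk_one, Fin.isValue, Matrix.cons_val_one, Matrix.cons_val_zero]
      exact continuous_const.mul hb1c
    · simp only [Fin.reduceFinMk, Matrix.cons_val]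
      exact continuous_const
  have hbsq : ∀ b : Metric.sphere (0 : EuclideanSpace ℝ (Fin 2)) 1,
      (b : EuclideanSpace ℝ (Fin 2)) 0 ^ 2 + (b : EuclideanSpace ℝ (Fin 2)) 1 ^ 2 = 1 := fun b => by
    have hn := norm_eq_of_mem_sphere b
    have : ‖(b : EuclideanSpace ℝ (Fin 2))‖ ^ 2 = 1 := by rw [hn]; norm_num
    rw [EuclideanSpace.norm_sq_eq, Fin.sum_univ_two] at this
    simpa [sq_abs] using this
  have hQ : ∀ b, yv b 0 ^ 2 + yv b 1 ^ 2 - yv b 2 ^ 2 = s := fun b => by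
    rw [hyv0, hyv1, hyv2, mul_pow, mul_pow, ← mul_add, hbsq, mul_one, hρsq]; ring
  have hnorm : ∀ b, ‖yv b‖ ^ 2 = s + 2 * y₂ ^ 2 := fun b => by
    rw [EuclideanSpace.norm_sq_eq, Fin.sum_univ_three]
    simp only [Real.norm_eq_abs, sq_abs]
    rw [hyv0, hyv1, hyv2, mul_pow, mul_pow, ← mul_add, hbsq, mul_one, hρsq]; ring
  have hballδ : ∀ b, yv b ∈ Metric.ball (0 : EuclideanSpace ℝ (Fin 3)) δ := fun b => by
    rw [mem_ball_zero_iff]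
    have h2 : ‖yv b‖ ^ 2 < δ ^ 2 := by rw [hnorm]; nlinarith
    exact lt_of_pow_lt_pow_left₀ 2 hδ.le h2
  have hballε : ∀ b, yv b ∈ Metric.ball (0 : EuclideanSpace ℝ (Fin 3)) ε := fun b =>
    Metric.ball_subset_ball hδε (hballδ b)
  have hballε₂ : ∀ b, yv b ∈ Metric.ball (0 : EuclideanSpace ℝ (Fin 3)) ε₂ := fun b =>
    Metric.ball_subset_ball hδε₂ (hballδ b)
  set uφ : Metric.sphere (0 : EuclideanSpace ℝ (Fin 2)) 1 := circlePt φ with huφ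
  set j₁ : Metric.sphere (0 : EuclideanSpace ℝ (Fin 2)) 1 → X := fun b => ν (uφ, yv b) with hj₁
  -- `f ∘ j₁ = f x`, so `j₁` lands in the fibre of `x`, at height `s`
  have hfj : ∀ b, f (j₁ b) = f x := fun b => by
    obtain ⟨e0, e1, e2⟩ := hT.formula uφ (yv b) (hballε b)
    rw [hQ b] at e0 e1 e2
    apply helper_degree_sphere_ext
    · rw [hj₁]; simp only; rw [e0, hf0, hcs]
    · rw [hj₁]; simp only; rw [e1, hf1, hcs]
    · rw [hj₁]; simp only; rw [e2, hfx2]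
  have hhj : ∀ b, (v : EuclideanSpace ℝ (Fin 3)) 2 *
      ((f (j₁ b) : Metric.sphere (0 : EuclideanSpace ℝ (Fin 3)) 1) : EuclideanSpace ℝ (Fin 3)) 2 = s :=
    fun b => by rw [hfj]; exact hxs
  -- `aC ∘ j₁ = aC x` by rigidity
  have haj : ∀ b, aC (j₁ b) = aC x := fun b => by
    have hr := hC.rigid uφ (yv b) (hballε₂ b) (by rw [hQ]; exact hs1) (by rw [hQ]; exact hs2)
    rw [hyv2, harctan] at hr
    apply Subtype.ext
    rw [hj₁]; simp only
    rw [hr, huφ, helper_degree_rigidDir_circlePt hσ θ φ, haC,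
      show σ * φ - θ / (2 * Real.pi) = ℓ + k by rw [hθ]; field_simp; ring]
    exact congrArg Subtype.val (circlePt_add_int ℓ k)
  -- the section of the collar through `j₁ b`: `j₁ b = ιC ((aC x, bC (j₁ b)), (circlePt φ, s))`
  have hsec : ∀ b, ιC ((aC x, bC (j₁ b)), (uφ, s)) = j₁ b := fun b => by
    obtain ⟨u'', hu''⟩ := hC.section_eq (j₁ b) (by rw [hhj]; exact hs1) (by rw [hhj]; exact hs2)
    rw [hhj, haj] at hu''
    obtain ⟨g0, g1, -, -, -⟩ := hC.formula (aC x) (bC (j₁ b)) u'' s hs1 hs2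
    rw [hu'', hfj] at g0 g1
    obtain ⟨-, hu''φ⟩ := helper_degree_unit_eq_of_smul_eq hc hsq (hf0.symm.trans g0)
      (hf1.symm.trans g1)
    rw [← hu''φ] at hu''
    exact hu''
  -- `J = bC ∘ j₁ : 𝕊¹ → 𝕊¹` is continuous and injective, hence onto
  set J : Metric.sphere (0 : EuclideanSpace ℝ (Fin 2)) 1 → Metric.sphere (0 : EuclideanSpace ℝ (Fin 2)) 1 :=
    fun b => bC (j₁ b) with hJ
  have hj₁c : Continuous j₁ :=
    hT.contMDiffOn.continuousOn.comp_continuous (continuous_const.prodMk hyvc)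
      fun b => ⟨mem_univ _, hballε b⟩
  have hJc : Continuous J :=
    hC.contMDiffOn_bC.continuousOn.comp_continuous hj₁c
      fun b => ⟨by rw [hhj]; exact hs1, by rw [hhj]; exact hs2⟩
  have hJinj : Injective J := by
    intro b b' hbb'
    have e' : j₁ b = j₁ b' := by
      rw [← hsec b, ← hsec b', show bC (j₁ b) = bC (j₁ b') from hbb']
    have e : ν (uφ, yv b) = ν (uφ, yv b') := by rw [hj₁] at e'; exact e'
    have hmb : (uφ, yv b) ∈ (univ : Set (Metric.sphere (0 : EuclideanSpace ℝ (Fin 2)) 1)) ×ˢ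
        Metric.ball (0 : EuclideanSpace ℝ (Fin 3)) ε := ⟨mem_univ _, hballε b⟩
    have hmb' : (uφ, yv b') ∈ (univ : Set (Metric.sphere (0 : EuclideanSpace ℝ (Fin 2)) 1)) ×ˢ
        Metric.ball (0 : EuclideanSpace ℝ (Fin 3)) ε := ⟨mem_univ _, hballε b'⟩
    have e2 : (uφ, yv b) = (uφ, yv b') := hT.injOn hmb hmb' e
    have e3 : yv b = yv b' := congrArg Prod.snd e2
    have e40 := congrArg (fun z : EuclideanSpace ℝ (Fin 3) => z 0) e3
    have e41 := congrArg (fun z : EuclideanSpace ℝ (Fin 3) => z 1) e3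
    simp only [hyv0, hyv1] at e40 e41
    apply Subtype.ext
    exact PiLp.ext (Fin.forall_fin_two.2
      ⟨mul_left_cancel₀ hρ0.ne' e40, mul_left_cancel₀ hρ0.ne' e41⟩)
  obtain ⟨b, hb⟩ := helper_degree_surjective_of_injective hJc hJinj (bC x)
  have hjx : j₁ b = x := by rw [← hsec b, show bC (j₁ b) = bC x from hb, hu']
  exact hx ⟨(uφ, yv b), ⟨mem_univ _, hballδ b⟩, hjx⟩

end Summit.SmoothPoincare4.SmoothPoincare4.Cruxes.RungOne.Sketch

end
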